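import Literature.MathematicalPhysics.QuantumFieldTheory.Balaban1983to89.HiggsFluctMeasure
import Literature.MathematicalPhysics.QuantumFieldTheory.Balaban1983to89.B3Sect1Counterterms

/-!
# `Balaban1983to89.B3Eq14AuxFunction` — T. Bałaban, *(Higgs)₂,₃ quantum fields in a finite volume. III.
Renormalization*, Commun. Math. Phys. **88** (1983) 411–445 [Balaban1983Higgs3], Sect. 1 p. 412: **the auxiliary
(generating) function `E_k(e′, λ′, Ω, A^{(k)}, φ)` of (1.4) WITH BODY** — a `k`-fold Gaussian integral over the
fluctuation fields against the measures `dμ_{C^{(j),L^jη}}` of `…HiggsFluctMeasure`, of the `k`-th renormalization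
transformation (I.2.4)–(I.2.5)/(I.2.10) on a region `Ω`, with the external field `e′g_kA′ + A^{(k)}` read through the
convention (1.3) (`…B3MultiscaleFields.holK13`), applied to the printed density; and the interaction (1.5) as r15's
`…B3Sect1Counterterms.pert15` of it

statement-level skeleton of published theorems with citation tags; proofs where landed; nothing here is a claim about the Yang–Mills mass gap

PDFs held: `paper:balaban1983-higgs-2-3-quantum-fields-finite-volume` (journal page = PDF page + 410) and
`paper:balaban1982-cmp85-higgs23-i` (journal page = PDF page + 602).  Displays read on the ×2 renders
`run/shared/lean/pub/pub-balaban/b2b-balaban-ref1/pages/1983-cmp88-higgs23-III/1983-cmp88-higgs23-III-p002-x2.png`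
(p. 412) and `…/1982-cmp85-higgs23-I/…-p006, -p007, -p016-x2.png` (pp. 608, 609, 618), never from the OCR layer.

CITATION HEADER (lean-in-tree rule).  lit-balaban typed skeleton (HOME `run/shared/lean/pub/lit-balaban/`), typer
line; SKELETON row **B3.Eq1.4** (owner r15 `lit-balaban-r15/ROWS-B3.md` v1.17: «absent (Gaussian-integral
definition; not modelled — Phase 2 with a concrete lattice Gaussian model)»).  THE SOURCE TEXT, p. 412 [PDF 2],
verbatim: *"Now we define an auxiliary function
E_k(e′, λ′, Ω, A^{(k)}, φ) = −log[ Π_{j=0}^{k−1} ∫dμ_{C^{(j),L^jη}}(A′_j) T^η_{a_k,L^k,e′g_kA′+A^{(k)}}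
 · [exp( −½⟨φ′, (−Δ^η_{e′g_kA′+A^{(k)}} + m²(L^kε)²)φ′⟩ − λ′λ(L^kε) Σ_{x∈Ω₁} η^d|φ′(x)|⁴
 − ½ Σ_{x∈Ω₁} η^d δm²(e′, g_k, λ′, Ω₁, x)·(L^kε)²|φ′(x)|² − E₁(e′, g_k, λ′, Ω₁) )]], (1.4)
where Ω₁ = B^k(Λ₇^{(k−1)′}) and δm²(e′, g_k, λ′, Ω₁, x), E₁(e′, g_k, λ′, Ω₁) will be defined later. The function g_k is
a smooth function with supp g_k ⊂ Ω₁, g_k(x) = 1 if dist(x, ∂Ω₁) ≧ M and bounded by 1 together with derivatives up to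
second order. The interaction after k steps is given by the formula 𝒫^{(k)}(Ω₁, A^{(k)}, φ) = Σ_{1≦α+β≦n̄} (1/(α!β!))
(∂^{β+β}/∂e′^α∂λ′^β E_k(e′, λ′, Ω, A^{(k)}, φ))|_{e′=λ′=0}. (1.5)"* ⟦sic: print misprints ∂^{β+β} for ∂^{α+β} in the
numerator of (1.5); the denominator ∂e′^α∂λ′^β and the range 1≦α+β≦n̄ fix the intent, and the declarations below read
∂^{α+β}⟧; with (1.1)–(1.3) of the same page (`A′ =
A′^{(0),η} + … + A′^{(k−1),η}`, `A′^{(j),η} = a_j(L^jη)^{−2}G^η_jQ_j^*A′_j`, the convention `A(Γ^{(k)}_{y,x}) = Σ_{j<k}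
A′^{(j),η}(Γ^{(j+1)}_{x_{j+1},x}) + A^{(k)}(Γ^{(k)}_{y,x})` — typed by r15 in `…B3MultiscaleFields`), and paper I p. 608
(2.4)–(2.5): *"the renormalization transformations for scalar fields on a subset Ω of the L^kε-lattice T^{(k)}_{L^kε}
satisfying the condition B(Ω′) = Ω: ρ′(A,ψ) = T^{L^kε}_{a,L,A}[Ω,ρ] = ∫dφ t^{L^kε}_{a,L,A}(Ω;ψ,φ)ρ(A,φ), (2.4)
t(Ω;ψ,φ) = Π_{y∈Ω′} t(ψ(y), φ↾_{B(y)}) (2.5)"*, p. 609 (2.10)–(2.11) (the `k`-th order kernel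
`(a_k(L^kε)^{d−2}/2π)^{N/2}exp(−½a_k(L^kε)^{d−2}|ψ(y) − (Q_k(A)φ)(y)|²)`, `(Q_k(A)φ)(y) = L^{−kd}Σ_{x∈B^k(y)}
U(A(Γ^{(k)}_{y,x}))φ(x)`).

HOW IT IS TYPED (reuse, nothing re-declared).  The carrier family `P` is III's `η`-lattice family (finest spacing
`P.mesh 0 = η`; level `k` = the unit lattice of the new fields when `η = L^{−k}`, not forced); the new scalar field
`φ : ScalarField P k N` lives on `T^{(k)}`, the old one `φ′` on `Ω = B^k(Ω^{(k)}) ⊂ T_η` (`region`); the fluctuation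
fields `A′_j : VecField P j`, `j < k`, are integrated against `HiggsFluctMeasure.fluctFamily` (= `Π_j dμ_{C^{(j),L^jη}}`);
`A^{(k)}` is an arbitrary `η`-lattice field (p. 412: *"with A^{(k)} replaced by Ã + B̃ … quite general fields"*).  The
external field `e′g_kA′ + A^{(k)}` enters TWICE, exactly as printed: in `−Δ^η_{(·)}` as the plain bond field
(`extField`, Neumann covariant Laplacian `HiggsCovariance.covLaplacianN` on `Ω`; `(g_kA′)_{⟨x,x+ηe_μ⟩} = g_k(x)A′_μ(x)`,
`siteMul`) and in `T^η_{a_k,L^k,(·)}` through the transports `U(𝒜(Γ^{(k)}_{y,x}))` with the CONVENTION (1.3)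
(`B3MultiscaleFields.holK13` at the pieces `(e′g_kA′)^{(j),η} = e′g_kA′^{(j),η}`, `extPieces`, and the top field
`A^{(k)}`; `avgQ14` = `Q_k`).  The transformation `T^η[Ω, ·]` is r14's generic `B1RT.rtOp`/`blockKernel` with the block
lattice `Ω^{(k)}` and the fine sites `Ω` (`∫dφ′↾_Ω` = product Lebesgue measure over the sites of `Ω`, fields extended by
`0` off `Ω`, `extendZero`), precision `a_k(L^kη)^{d−2}` (`B1RT.prec (B1.aSeq a L k) (P.mesh k) d`, (I.2.10)).  The
counterterms `δm²`, `E₁` (*"will be defined later"* = (1.29)/(1.30), r15 `B3Sect1Counterterms.dm2Total/E1Total`) are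
SUPPLIED functions of `(e′, λ′, x)` resp. `(e′, λ′)` (fields `dm2`, `E1` of `Data14`; r15's `dm2Total` is the
product `δm²·(L^kε)²`), the running couplings `e(L^kε)` (inside the coupling `C` of `U`), `λ(L^kε)` (`lamRun`), the
masses `μ₀²(L^kε)²` (`msq`, inside `G^η_j`) and `m²`, `L^kε` (`m2`, `ell`) are parameters; `g_k` is a parameter whose
printed properties are the Prop `IsCutoff14` (recorded, not used by the definition).  (1.4) = `auxE`; (1.5) =
`interaction15` := `B3Sect1Counterterms.pert15` of `(e′, λ′) ↦ auxE … e′ λ′ A^{(k)} φ`.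
PROVED (kernel, bookkeeping only): unfolding lemmas, positivity of the density and of the kernel, `k = 0` / `e′ = 0`
degenerations of the external field, and `interaction15` = r12's `B1Sect3Statements.pertSum362` at `e = λ = 1` minus
the constant term (`interaction15_eq`).  Paper I's (3.35) p. 618 is the case `Ω = Ω₁ = T`, `g_k = 1` of (1.4) up to
the normalisations `Z^{(j)}` (see `HiggsFluctMeasure.integral_fluctMeasure`); it is NOT restated here (row B1.Eq3.35,
decl of record p14's `B1Eq365Proof.genFn335`).  DELIBERATELY NOT HERE: convergence/analyticity of (1.4) in `(e′, λ′)`,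
the graph expansion (1.12)–(1.18) (rows B3.Eq1.12-…, `B3Prop1`), the counterterm pieces (1.23)–(1.30).
v1.1 (append-only, on the request of the B3 fold owner r15 g4, typer INBOX 06:02:09Z): §4 KNITS (1.4) to (1.29)/(1.30) —
`Pieces129` (the printed pieces δm²_fin, δm²_{K,k}, δm²_k, E_fin, E_{K,k}, E_k and the running charge e(L^kε)) and
`Data14.withTotals` (the data whose `dm2`/`E1` ARE r15's `B3Sect1Counterterms.dm2Total`/`E1Total` of the pieces at
`(e′, g_k, λ′, Ω₁)`; `dm2Total` is `δm²·(L^kε)²`, so `dm2 := dm2Total/ℓ²`), with (1.29)/(1.30) recovered verbatim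
(`withTotals_eq129`, `withTotals_eq130`) and the density/function (1.4) of the knitted data displayed with the assembled
counterterms (`withTotals_density14`, `withTotals_auxE`); v1 declarations byte-identical.
v1.2 (DOCSTRING ONLY, typer gen 25; the defect class of referee ref-1's gen-67 F1 ask on the sibling
`B3Eq15OneSidedInteraction`, self-found here): the p. 412 quotation above now TRANSCRIBES the print's misprinted numerator
«∂^{β+β}» of (1.5) with a ⟦sic⟧ note (v1/v1.1 had silently corrected it to «∂^{α+β}» inside the verbatim marks; renders
`1983-cmp88-higgs23-III-p002-x2.png` and `…-p002-x4.png` re-read); every declaration, statement and proof byte-identical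
to v1.1.  Later companions of this file by the same unit: `B3Eq15OneSidedInteraction` (g24 semantic audit: `auxE = 0`
for `λ′ < 0` under Lean's Bochner conventions; repaired one-sided (1.5) `interaction15R`) and `B3Eq14Finite` (g25: on
`λ′ ≥ 0` the integral of (1.4) is positive and finite, `E_k` continuous and a priori bounded in the fields).
Unit `lit-balaban-typer` gen 4 (literature-prover-lit-balaban-typer-g4-0); HOME/FILED.md records the proposal.
-/

open scoped BigOperators ENNReal
open _root_.MeasureTheory

namespace Literature.MathematicalPhysics.QuantumFieldTheory.Balaban1983to89.B3Eq14AuxFunction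

open Literature.MathematicalPhysics.QuantumFieldTheory.Balaban1983to89.HiggsLattice
open Literature.MathematicalPhysics.QuantumFieldTheory.Balaban1983to89.HiggsAveraging
open Literature.MathematicalPhysics.QuantumFieldTheory.Balaban1983to89.HiggsCovariance
open Literature.MathematicalPhysics.QuantumFieldTheory.Balaban1983to89.B3MultiscaleFields
open Literature.MathematicalPhysics.QuantumFieldTheory.Balaban1983to89.HiggsFluctMeasure
open Literature.MathematicalPhysics.QuantumFieldTheory.Balaban1983to89.B1RT

variable {P : Params} {N : ℕ}

/-! ## 1. Regions, the cut-off `g_k`, fields on `Ω` -/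

section Regions

/-- `Ω = B^k(Ω^{(k)})` — the region of the `η`-lattice over the block-lattice region `Ω^{(k)} ⊂ T^{(k)}` (paper I p. 608:
*"a subset Ω of the L^kε-lattice … satisfying the condition B(Ω′) = Ω"*, iterated `k` times as in (I.2.10);
`HiggsAveraging.blockIter k x = x_k`). [cite: Balaban1982Higgs1, (2.4) p.608] -/
def region (k : ℕ) (Ωk : Finset (Site P k)) : Finset (Site P 0) :=
  Finset.univ.filter fun x => blockIter k x ∈ Ωk

/-- `x ∈ B^k(Ω^{(k)}) ↔ x_k ∈ Ω^{(k)}`. [cite: Balaban1982Higgs1, (2.4) p.608] -/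
theorem mem_region (k : ℕ) (Ωk : Finset (Site P k)) (x : Site P 0) : x ∈ region k Ωk ↔ blockIter k x ∈ Ωk := by
  simp [region]

/-- `B^k` of the whole block lattice is the whole `η`-lattice (the case `Ω = T` of paper I). [cite: Balaban1982Higgs1, (2.10) p.609] -/
theorem region_univ (k : ℕ) : region k (Finset.univ : Finset (Site P k)) = Finset.univ := by
  ext x
  simp [region]

/-- `B^k(y) ⊂ B^k(Ω^{(k)})` for `y ∈ Ω^{(k)}` (`HiggsAveraging.blockK k y = B^k(y)`). [cite: Balaban1982Higgs1, (2.11) p.609] -/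
theorem blockK_subset_region (k : ℕ) {Ωk : Finset (Site P k)} {y : Site P k} (hy : y ∈ Ωk) :
    blockK k y ⊆ region k Ωk := by
  intro x hx
  rw [mem_region, (mem_blockK k y x).mp hx]
  exact hy

/-- A scalar field on the sites of `Ω` extended by `0` to the whole lattice (*"∫dφ↾_Ω"*: the transformation (I.2.4)
integrates over the field on `Ω` only; off `Ω` the Neumann operator and the block averages over `B^k(Ω^{(k)})` do not
see the field). [cite: Balaban1982Higgs1, (2.4) p.608] -/
def extendZero (Ω : Finset (Site P 0)) (φΩ : ↥Ω → EuclideanSpace ℝ (Fin N)) : ScalarField P 0 N :=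
  fun x => if h : x ∈ Ω then φΩ ⟨x, h⟩ else 0

/-- On `Ω` the extension is the given field. [cite: Balaban1982Higgs1, (2.4) p.608] -/
theorem extendZero_of_mem (Ω : Finset (Site P 0)) (φΩ : ↥Ω → EuclideanSpace ℝ (Fin N)) {x : Site P 0}
    (hx : x ∈ Ω) : extendZero Ω φΩ x = φΩ ⟨x, hx⟩ := by
  simp [extendZero, hx]

/-- Off `Ω` the extension vanishes. [cite: Balaban1982Higgs1, (2.4) p.608] -/
theorem extendZero_of_not_mem (Ω : Finset (Site P 0)) (φΩ : ↥Ω → EuclideanSpace ℝ (Fin N)) {x : Site P 0}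
    (hx : x ∉ Ω) : extendZero Ω φΩ x = 0 := by
  simp [extendZero, hx]

/-- Extension by zero of the whole-lattice field is the field (case `Ω = T`). [cite: Balaban1982Higgs1, (2.10) p.609] -/
theorem extendZero_univ (φ : ↥(Finset.univ : Finset (Site P 0)) → EuclideanSpace ℝ (Fin N)) (x : Site P 0) :
    extendZero Finset.univ φ x = φ ⟨x, Finset.mem_univ x⟩ :=
  extendZero_of_mem _ _ (Finset.mem_univ x)

/-- The product `g·A` of a site function with a vector (bond) field: `(gA)_{⟨x,x+ηe_μ⟩} = g(x)A_μ(x)` — how the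
cut-off `g_k` multiplies the fluctuation field in `e′g_kA′` (p. 419: *"functions g_k multiplying each leg of the vector
field (or each coupling constant e)"*). [cite: Balaban1983Higgs3, (1.4) p.412] -/
def siteMul (g : Site P 0 → ℝ) (A : VecField P 0) : VecField P 0 := fun b => g b.src * A b

/-- `g·A` unfolds bondwise. [cite: Balaban1983Higgs3, (1.4) p.412] -/
theorem siteMul_apply (g : Site P 0 → ℝ) (A : VecField P 0) (b : PBond P 0) : siteMul g A b = g b.src * A b := rfl

/-- `g·(A + B) = g·A + g·B`. [cite: Balaban1983Higgs3, (1.4) p.412] -/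
theorem siteMul_add (g : Site P 0 → ℝ) (A B : VecField P 0) : siteMul g (A + B) = siteMul g A + siteMul g B := by
  funext b
  simp [siteMul, mul_add]

/-- `g·(Σ_i A_i) = Σ_i g·A_i`. [cite: Balaban1983Higgs3, (1.4) p.412] -/
theorem siteMul_sum {ι : Type*} (s : Finset ι) (g : Site P 0 → ℝ) (A : ι → VecField P 0) :
    siteMul g (∑ i ∈ s, A i) = ∑ i ∈ s, siteMul g (A i) := by
  funext b
  simp [siteMul, Finset.mul_sum]

/-- `g·(c A) = c (g·A)`. [cite: Balaban1983Higgs3, (1.4) p.412] -/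
theorem siteMul_smul (g : Site P 0 → ℝ) (c : ℝ) (A : VecField P 0) : siteMul g (c • A) = c • siteMul g A := by
  funext b
  simp [siteMul]
  ring

/-- With `g = 1` the product is the field. [cite: Balaban1983Higgs3, (1.4) p.412] -/
theorem siteMul_one (A : VecField P 0) : siteMul (fun _ => (1 : ℝ)) A = A := by
  funext b
  simp [siteMul]

/-- The second difference derivative `∂^η_μ∂^η_ν g` of a site function ((I.1.4) iterated). [cite: Balaban1982Higgs1, (1.4) p.604] -/
noncomputable def sderiv₂ (g : Site P 0 → ℝ) (μ ν : Fin P.d) (x : Site P 0) : ℝ :=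
  sderiv (fun y => sderiv g ⟨y, ν⟩) ⟨x, μ⟩

/-- `x` lies at distance `≥ M` from the complement of `Ω₁` (lattice reading of *"dist(x, ∂Ω₁) ≧ M"* for `x ∈ Ω₁`:
every site at physical torus distance `< M` from `x` is in `Ω₁`; `HiggsLattice.Site.tdist` = distance in lattice
units, `η = P.mesh 0`). [cite: Balaban1983Higgs3, (1.4) p.412] -/
def FarInside (Ω₁ : Finset (Site P 0)) (M : ℝ) (x : Site P 0) : Prop :=
  ∀ y : Site P 0, P.mesh 0 * (Site.tdist x y : ℝ) < M → y ∈ Ω₁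

/-- The printed properties of the cut-off `g_k`, p. 412 [PDF 2], verbatim: *"The function g_k is a smooth function with
supp g_k ⊂ Ω₁, g_k(x) = 1 if dist(x, ∂Ω₁) ≧ M and bounded by 1 together with derivatives up to second order."* —
recorded as a Prop on the parameter `g` of `Data14` (lattice reading: "smooth" carries no content on a lattice beyond
the stated bounds on the difference derivatives (I.1.4)). [cite: Balaban1983Higgs3, (1.4) p.412] -/
structure IsCutoff14 (g : Site P 0 → ℝ) (Ω₁ : Finset (Site P 0)) (M : ℝ) : Prop where
  supp : ∀ x, x ∉ Ω₁ → g x = 0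
  eq_one : ∀ x, FarInside Ω₁ M x → g x = 1
  abs_le : ∀ x, |g x| ≤ 1
  sderiv_le : ∀ b : PBond P 0, |sderiv g b| ≤ 1
  sderiv₂_le : ∀ (μ ν : Fin P.d) (x : Site P 0), |sderiv₂ g μ ν x| ≤ 1

end Regions

/-! ## 2. The data of (1.4) -/

/-- The data entering (1.4) p. 412 besides the displayed arguments `(e′, λ′, A^{(k)}, φ)`: the coupling `C` of the
transports `U = exp(qηeA)` (with the running charge `e = e(L^kε)` of the unit-lattice picture, p. 419), the
vector-field mass `msq` (`= μ₀²(L^kε)²`) and precision `a` of the fluctuation covariances `C^{(j),L^jη}`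
(`HiggsFluctMeasure`), the block-lattice region `Ωk = Ω^{(k)}` (so that `Ω = B^k(Ω^{(k)})`, *"B(Ω′) = Ω"*), the region
`Ω₁ = B^k(Λ₇^{(k−1)′})`, the cut-off `g = g_k`, the scalar mass `m2 = m²`, the scale `ell = L^kε`, the running quartic
coupling `lamRun = λ(L^kε)`, and the counterterms *"δm²(e′, g_k, λ′, Ω₁, x), E₁(e′, g_k, λ′, Ω₁) [which] will be
defined later"* as supplied functions of `(e′, λ′, x)` / `(e′, λ′)` ((1.29)/(1.30): r15 `B3Sect1Counterterms.dm2Total`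
is the product `δm²·(L^kε)²`, i.e. `fun e′ λ′ x => dm2 e′ λ′ x * ell^2`). [cite: Balaban1983Higgs3, (1.4) p.412] -/
structure Data14 (P : Params) (N k : ℕ) where
  C : ChargeData N
  msq : ℝ
  a : ℝ
  Ωk : Finset (Site P k)
  Ω₁ : Finset (Site P 0)
  g : Site P 0 → ℝ
  m2 : ℝ
  ell : ℝ
  lamRun : ℝ
  dm2 : ℝ → ℝ → Site P 0 → ℝ
  E1 : ℝ → ℝ → ℝ

namespace Data14

variable {k : ℕ} (D : Data14 P N k)

/-- The region `Ω = B^k(Ω^{(k)})` of the data. [cite: Balaban1982Higgs1, (2.4) p.608] -/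
def Ω : Finset (Site P 0) := region k D.Ωk

/-- `x ∈ Ω ↔ x_k ∈ Ω^{(k)}`. [cite: Balaban1982Higgs1, (2.4) p.608] -/
theorem mem_Ω (x : Site P 0) : x ∈ D.Ω ↔ blockIter k x ∈ D.Ωk := mem_region k D.Ωk x

/-! ### The external field `e′g_kA′ + A^{(k)}` -/

/-- `A′ = A′^{(0),η} + … + A′^{(k−1),η}` of (1.1) p. 412 for a family `(A′_j)_{j<k}` of fluctuation fields
(`B3MultiscaleFields.fluctPiece` = (1.2)). [cite: Balaban1983Higgs3, (1.1) p.412] -/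
noncomputable def fluctSum (A' : (j : Fin k) → VecField P j) : VecField P 0 :=
  ∑ j : Fin k, fluctPiece D.msq D.a j (A' j)

/-- The external vector field `e′g_kA′ + A^{(k)}` of (1.4) as a plain `η`-lattice bond field (the subscript of
`−Δ^η_{e′g_kA′+A^{(k)}}`). [cite: Balaban1983Higgs3, (1.4) p.412] -/
noncomputable def extField (Ak : VecField P 0) (e' : ℝ) (A' : (j : Fin k) → VecField P j) : VecField P 0 :=
  e' • siteMul D.g (D.fluctSum A') + Ak

/-- Unfolding of `extField`. [cite: Balaban1983Higgs3, (1.4) p.412] -/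
theorem extField_eq (Ak : VecField P 0) (e' : ℝ) (A' : (j : Fin k) → VecField P j) :
    D.extField Ak e' A' = e' • siteMul D.g (D.fluctSum A') + Ak := rfl

/-- At `e′ = 0` the external field is `A^{(k)}` alone (the point at which (1.5) differentiates). [cite: Balaban1983Higgs3, (1.5) p.412] -/
theorem extField_zero (Ak : VecField P 0) (A' : (j : Fin k) → VecField P j) : D.extField Ak 0 A' = Ak := by
  simp [extField]

/-- The pieces `(e′g_kA′)^{(j),η} = e′g_kA′^{(j),η}`, `j < k`, of the fluctuation part of the external field, for the
convention (1.3) (zero for `j ≥ k`). [cite: Balaban1983Higgs3, (1.3) p.412] -/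
noncomputable def extPieces (e' : ℝ) (A' : (j : Fin k) → VecField P j) (j : ℕ) : VecField P 0 :=
  if h : j < k then e' • siteMul D.g (fluctPiece D.msq D.a j (A' ⟨j, h⟩)) else 0

/-- For `j < k` the `j`-th piece is `e′g_kA′^{(j),η}`. [cite: Balaban1983Higgs3, (1.3) p.412] -/
theorem extPieces_of_lt (e' : ℝ) (A' : (j : Fin k) → VecField P j) {j : ℕ} (h : j < k) :
    D.extPieces e' A' j = e' • siteMul D.g (fluctPiece D.msq D.a j (A' ⟨j, h⟩)) := by
  simp [extPieces, h]

/-- At `e′ = 0` all fluctuation pieces vanish. [cite: Balaban1983Higgs3, (1.5) p.412] -/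
theorem extPieces_zero (A' : (j : Fin k) → VecField P j) (j : ℕ) : D.extPieces 0 A' j = 0 := by
  unfold extPieces
  split_ifs <;> simp

/-- The sum of the pieces is the fluctuation part of `extField`: `Σ_{j<k} e′g_kA′^{(j),η} = e′g_kA′` (linearity of
`g·(·)`), so that the plain field of `−Δ^η_{(·)}` and the field of the transports are the same `e′g_kA′ + A^{(k)}` read
in the two printed ways. [cite: Balaban1983Higgs3, (1.4) p.412] -/
theorem sum_extPieces (Ak : VecField P 0) (e' : ℝ) (A' : (j : Fin k) → VecField P j) :
    (∑ j ∈ Finset.range k, D.extPieces e' A' j) + Ak = D.extField Ak e' A' := by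
  rw [extField_eq, fluctSum, siteMul_sum, Finset.smul_sum, Finset.sum_range fun j => D.extPieces e' A' j]
  refine congrArg (· + Ak) (Finset.sum_congr rfl fun j _ => ?_)
  rw [extPieces_of_lt D e' A' j.isLt]

/-- **`Q_k(e′g_kA′ + A^{(k)})` with the convention (1.3)**: `(Q_kφ′)(y) = L^{−kd} Σ_{x∈B^k(y)} U(𝒜(Γ^{(k)}_{y,x}))φ′(x)`
((I.2.11) p. 609) where `𝒜(Γ^{(k)}_{y,x}) = Σ_{j<k}(e′g_kA′)^{(j),η}(Γ^{(j+1)}_{x_{j+1},x}) + A^{(k)}(Γ^{(k)}_{y,x})` is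
(1.3) — the transport is r15's `B3MultiscaleFields.holK13`. [cite: Balaban1983Higgs3, (1.3)–(1.4) p.412] -/
noncomputable def avgQ14 (Ak : VecField P 0) (e' : ℝ) (A' : (j : Fin k) → VecField P j) (φ' : ScalarField P 0 N) :
    ScalarField P k N :=
  fun y => (((P.L : ℝ) ^ (k * P.d))⁻¹) • ∑ x ∈ blockK k y, holK13 D.C k (D.extPieces e' A') Ak x (φ' x)

/-- Unfolding of `avgQ14`. [cite: Balaban1983Higgs3, (1.4) p.412] -/
theorem avgQ14_apply (Ak : VecField P 0) (e' : ℝ) (A' : (j : Fin k) → VecField P j) (φ' : ScalarField P 0 N)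
    (y : Site P k) :
    D.avgQ14 Ak e' A' φ' y
      = (((P.L : ℝ) ^ (k * P.d))⁻¹) • ∑ x ∈ blockK k y, holK13 D.C k (D.extPieces e' A') Ak x (φ' x) := rfl

/-- At `e′ = 0` the averaging operator is paper I's `Q_k(A^{(k)})` (`HiggsAveraging.avgQk`; the factor `η` of III's
`A(Γ) = Σ ηA_b` moves into `U`, `B3MultiscaleFields.holK13_top_only`). [cite: Balaban1982Higgs1, (2.11) p.609] -/
theorem avgQ14_zero (Ak : VecField P 0) (A' : (j : Fin k) → VecField P j) (φ' : ScalarField P 0 N) :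
    D.avgQ14 Ak 0 A' φ' = avgQk D.C Ak k φ' := by
  funext y
  rw [avgQ14_apply, avgQk_apply]
  refine congrArg _ (Finset.sum_congr rfl fun x _ => ?_)
  have h : D.extPieces 0 A' = fun _ => 0 := funext fun j => D.extPieces_zero A' j
  rw [h, holK13_top_only]

/-! ### The transformation `T^η_{a_k,L^k,e′g_kA′+A^{(k)}}[Ω, ·]` ((I.2.4)–(I.2.5), (I.2.10)) -/

/-- The kernel `t^η_{a_k,L^k,𝒜}(Ω; φ, φ′) = Π_{y∈Ω^{(k)}} (a_k(L^kη)^{d−2}/2π)^{N/2} exp(−½a_k(L^kη)^{d−2}|φ(y) −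
(Q_k(𝒜)φ′)(y)|²)` of (I.2.5)/(I.2.10) p. 608–609 for `𝒜 = e′g_kA′ + A^{(k)}` read through (1.3): r14's generic
`B1RT.blockKernel` with block lattice `Ω^{(k)}`, fine sites `Ω`, precision `B1RT.prec (a_k) (L^kη) d` and block average
`avgQ14` of the zero-extended field. [cite: Balaban1982Higgs1, (2.10) p.609] -/
noncomputable def kernel14 (Ak : VecField P 0) (e' : ℝ) (A' : (j : Fin k) → VecField P j) (φ : ScalarField P k N)
    (φΩ : ↥D.Ω → EuclideanSpace ℝ (Fin N)) : ℝ :=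
  blockKernel (prec (B1.aSeq D.a P.L k) (P.mesh k) P.d)
    (fun (ψΩ : ↥D.Ω → EuclideanSpace ℝ (Fin N)) (y : ↥D.Ωk) => D.avgQ14 Ak e' A' (extendZero D.Ω ψΩ) y.1)
    (fun y : ↥D.Ωk => φ y.1) φΩ

/-- Unfolding of `kernel14` as the printed product over `y ∈ Ω^{(k)}`. [cite: Balaban1982Higgs1, (2.5) p.608] -/
theorem kernel14_eq (Ak : VecField P 0) (e' : ℝ) (A' : (j : Fin k) → VecField P j) (φ : ScalarField P k N)
    (φΩ : ↥D.Ω → EuclideanSpace ℝ (Fin N)) :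
    D.kernel14 Ak e' A' φ φΩ
      = ∏ y : ↥D.Ωk, rtKernel (prec (B1.aSeq D.a P.L k) (P.mesh k) P.d)
          (φ y.1 - D.avgQ14 Ak e' A' (extendZero D.Ω φΩ) y.1) := rfl

/-- `a_k = a(1 − L^{−2})/(1 − L^{−2k}) ≥ 0` ((I.2.15) p. 609) for `a ≥ 0` and the model's `L ≥ 1` (same proof as
`B1Ineq337HiggsModel.aSeq_nonneg`, restated to keep the imports of this file minimal). [cite: Balaban1982Higgs1, (2.15) p.609] -/
theorem aSeq_nonneg' (ha : 0 ≤ D.a) (j : ℕ) : 0 ≤ B1.aSeq D.a P.L j := by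
  rw [B1.aSeq_eq]
  have hL : (1 : ℝ) ≤ (P.L : ℝ) := by exact_mod_cast P.hL
  have h1 : ((P.L : ℝ) ^ 2)⁻¹ ≤ 1 := inv_le_one_of_one_le₀ (one_le_pow₀ hL)
  have h0 : 0 ≤ ((P.L : ℝ) ^ 2)⁻¹ := inv_nonneg.2 (sq_nonneg _)
  exact div_nonneg (mul_nonneg ha (sub_nonneg.2 h1)) (sub_nonneg.2 (pow_le_one₀ h0 h1))

/-- The kernel is non-negative for `a ≥ 0` (then `a_k ≥ 0`). [cite: Balaban1982Higgs1, (2.5) p.608] -/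
theorem kernel14_nonneg (ha : 0 ≤ D.a) (Ak : VecField P 0) (e' : ℝ) (A' : (j : Fin k) → VecField P j)
    (φ : ScalarField P k N) (φΩ : ↥D.Ω → EuclideanSpace ℝ (Fin N)) : 0 ≤ D.kernel14 Ak e' A' φ φΩ := by
  rw [kernel14_eq]
  refine Finset.prod_nonneg fun y _ => rtKernel_nonneg ?_ _
  unfold prec
  exact mul_nonneg (D.aSeq_nonneg' ha k) (zpow_nonneg (P.mesh_pos k).le _)

/-- **`T^η_{a_k,L^k,e′g_kA′+A^{(k)}}[Ω, F](φ) = ∫dφ′↾_Ω t(Ω; φ, φ′) F(φ′)`** — (I.2.4) p. 608 with the kernel (I.2.10)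
for the external field of (1.4): r14's `B1RT.rtOp` (`∫dφ′↾_Ω` = product Lebesgue measure over the sites of `Ω`, the
density evaluated on the zero-extended field). [cite: Balaban1982Higgs1, (2.4) p.608] -/
noncomputable def rt14 (Ak : VecField P 0) (e' : ℝ) (A' : (j : Fin k) → VecField P j)
    (F : ScalarField P 0 N → ℝ) (φ : ScalarField P k N) : ℝ :=
  rtOp (D.kernel14 Ak e' A') (fun φΩ => F (extendZero D.Ω φΩ)) φ

/-- Unfolding of `rt14` as the printed integral `∫dφ′↾_Ω t(Ω; φ, φ′)F(φ′)`. [cite: Balaban1982Higgs1, (2.4) p.608] -/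
theorem rt14_eq (Ak : VecField P 0) (e' : ℝ) (A' : (j : Fin k) → VecField P j) (F : ScalarField P 0 N → ℝ)
    (φ : ScalarField P k N) :
    D.rt14 Ak e' A' F φ
      = ∫ φΩ : ↥D.Ω → EuclideanSpace ℝ (Fin N), D.kernel14 Ak e' A' φ φΩ * F (extendZero D.Ω φΩ) := rfl

/-- `T[Ω, ·]` depends on the new field `φ` only through `φ↾_{Ω^{(k)}}`. [cite: Balaban1982Higgs1, (2.5) p.608] -/
theorem rt14_congr (Ak : VecField P 0) (e' : ℝ) (A' : (j : Fin k) → VecField P j) (F : ScalarField P 0 N → ℝ)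
    {φ₁ φ₂ : ScalarField P k N} (h : ∀ y ∈ D.Ωk, φ₁ y = φ₂ y) :
    D.rt14 Ak e' A' F φ₁ = D.rt14 Ak e' A' F φ₂ := by
  simp only [rt14, rtOp_eq, kernel14_eq]
  refine integral_congr_ae (Filter.Eventually.of_forall fun φΩ => ?_)
  have hp : ∀ y : ↥D.Ωk, φ₁ y.1 = φ₂ y.1 := fun y => h y.1 y.2
  simp only [hp]

/-! ### The density and the function `E_k` (1.4), the interaction (1.5) -/

/-- The operator `−Δ^η_{e′g_kA′+A^{(k)},Ω} + m²(L^kε)²` of the quadratic form in (1.4) p. 412 (Neumann covariant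
Laplacian on `Ω`, `HiggsCovariance.covLaplacianN`, at the external field `extField`). [cite: Balaban1983Higgs3, (1.4) p.412] -/
noncomputable def scalarOp (Ak : VecField P 0) (e' : ℝ) (A' : (j : Fin k) → VecField P j) :
    ScalarField P 0 N →ₗ[ℝ] ScalarField P 0 N :=
  covLaplacianN D.C D.Ω (D.extField Ak e' A') + (D.m2 * D.ell ^ 2) • LinearMap.id

/-- Unfolding of `scalarOp`. [cite: Balaban1983Higgs3, (1.4) p.412] -/
theorem scalarOp_eq (Ak : VecField P 0) (e' : ℝ) (A' : (j : Fin k) → VecField P j) :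
    D.scalarOp Ak e' A' = covLaplacianN D.C D.Ω (D.extField Ak e' A') + (D.m2 * D.ell ^ 2) • LinearMap.id := rfl

/-- At `e′ = 0` the operator is `−Δ^η_{A^{(k)},Ω} + m²(L^kε)²`. [cite: Balaban1983Higgs3, (1.5) p.412] -/
theorem scalarOp_zero (Ak : VecField P 0) (A' : (j : Fin k) → VecField P j) :
    D.scalarOp Ak 0 A' = covLaplacianN D.C D.Ω Ak + (D.m2 * D.ell ^ 2) • LinearMap.id := by
  rw [scalarOp_eq, extField_zero]

/-- The DENSITY of (1.4) p. 412 (the bracket `[exp(…)]` to which `T^η` is applied), as a function of the old scalar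
field `φ′` on the `η`-lattice: `exp( −½⟨φ′, (−Δ^η_{e′g_kA′+A^{(k)},Ω} + m²(L^kε)²)φ′⟩ − λ′λ(L^kε)Σ_{x∈Ω₁}η^d|φ′(x)|⁴
− ½Σ_{x∈Ω₁}η^dδm²(e′,g_k,λ′,Ω₁,x)(L^kε)²|φ′(x)|² − E₁(e′,g_k,λ′,Ω₁) )` (scalar product (I.1.5) `HiggsLattice.siteInner`).
[cite: Balaban1983Higgs3, (1.4) p.412] -/
noncomputable def density14 (Ak : VecField P 0) (e' lam' : ℝ) (A' : (j : Fin k) → VecField P j)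
    (φ' : ScalarField P 0 N) : ℝ :=
  Real.exp
    (-(1 / 2 : ℝ) * siteInner φ' (D.scalarOp Ak e' A' φ')
      - lam' * D.lamRun * ∑ x ∈ D.Ω₁, P.mesh 0 ^ P.d * ‖φ' x‖ ^ 4
      - (1 / 2 : ℝ) * ∑ x ∈ D.Ω₁, P.mesh 0 ^ P.d * D.dm2 e' lam' x * D.ell ^ 2 * ‖φ' x‖ ^ 2
      - D.E1 e' lam')

/-- Unfolding of `density14`. [cite: Balaban1983Higgs3, (1.4) p.412] -/
theorem density14_eq (Ak : VecField P 0) (e' lam' : ℝ) (A' : (j : Fin k) → VecField P j) (φ' : ScalarField P 0 N) :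
    D.density14 Ak e' lam' A' φ'
      = Real.exp
        (-(1 / 2 : ℝ) * siteInner φ' (D.scalarOp Ak e' A' φ')
          - lam' * D.lamRun * ∑ x ∈ D.Ω₁, P.mesh 0 ^ P.d * ‖φ' x‖ ^ 4
          - (1 / 2 : ℝ) * ∑ x ∈ D.Ω₁, P.mesh 0 ^ P.d * D.dm2 e' lam' x * D.ell ^ 2 * ‖φ' x‖ ^ 2
          - D.E1 e' lam') := rfl

/-- The density is positive. [cite: Balaban1983Higgs3, (1.4) p.412] -/
theorem density14_pos (Ak : VecField P 0) (e' lam' : ℝ) (A' : (j : Fin k) → VecField P j) (φ' : ScalarField P 0 N) :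
    0 < D.density14 Ak e' lam' A' φ' :=
  Real.exp_pos _

/-- The integrand of the outer Gaussian integrals of (1.4): the fluctuation family `(A′_j)_{j<k}` ↦
`T^η_{a_k,L^k,e′g_kA′+A^{(k)}}[Ω, density](φ)`. [cite: Balaban1983Higgs3, (1.4) p.412] -/
noncomputable def integrand14 (e' lam' : ℝ) (Ak : VecField P 0) (φ : ScalarField P k N)
    (A' : (j : Fin k) → VecField P j) : ℝ :=
  D.rt14 Ak e' A' (D.density14 Ak e' lam' A') φ

/-- **(1.4)** p. 412 [PDF 2] — the auxiliary (generating) function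
`E_k(e′, λ′, Ω, A^{(k)}, φ) = −log[ Π_{j=0}^{k−1}∫dμ_{C^{(j),L^jη}}(A′_j) T^η_{a_k,L^k,e′g_kA′+A^{(k)}}[Ω, exp(…)](φ) ]`
WITH BODY: minus the logarithm of the integral of `integrand14` against the product Gaussian measure
`HiggsFluctMeasure.fluctFamily` of the fluctuation fields. [cite: Balaban1983Higgs3, (1.4) p.412] -/
noncomputable def auxE (e' lam' : ℝ) (Ak : VecField P 0) (φ : ScalarField P k N) : ℝ :=
  -Real.log (∫ A', D.integrand14 e' lam' Ak φ A' ∂(fluctFamily P D.msq D.a k))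

/-- Unfolding of `auxE` = (1.4) as printed: `−log ∫(Π_j dμ_{C^{(j)}})(A′) ∫dφ′↾_Ω t(Ω;φ,φ′)·density(φ′)`.
[cite: Balaban1983Higgs3, (1.4) p.412] -/
theorem auxE_eq (e' lam' : ℝ) (Ak : VecField P 0) (φ : ScalarField P k N) :
    D.auxE e' lam' Ak φ
      = -Real.log (∫ A', D.rt14 Ak e' A' (D.density14 Ak e' lam' A') φ ∂(fluctFamily P D.msq D.a k)) := rfl

/-- `E_k` depends on the new field only through `φ↾_{Ω^{(k)}}`. [cite: Balaban1983Higgs3, (1.4) p.412] -/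
theorem auxE_congr (e' lam' : ℝ) (Ak : VecField P 0) {φ₁ φ₂ : ScalarField P k N} (h : ∀ y ∈ D.Ωk, φ₁ y = φ₂ y) :
    D.auxE e' lam' Ak φ₁ = D.auxE e' lam' Ak φ₂ := by
  simp only [auxE_eq, D.rt14_congr Ak e' _ _ h]

/-- With no step done (`k = 0`) there is no fluctuation integral: `E_0 = −log T^η[Ω, density](φ)` at the empty
family (`HiggsFluctMeasure.fluctFamily_zero`). [cite: Balaban1983Higgs3, (1.4) p.412] -/
theorem auxE_zero_steps (D : Data14 P N 0) (e' lam' : ℝ) (Ak : VecField P 0) (φ : ScalarField P 0 N) :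
    D.auxE e' lam' Ak φ = -Real.log (D.integrand14 e' lam' Ak φ fun j => j.elim0) := by
  rw [auxE, fluctFamily_zero, integral_dirac]

/-- **(1.5)** p. 412 — the interaction after `k` steps, `𝒫^{(k)}(Ω₁, A^{(k)}, φ) = Σ_{1≦α+β≦n̄}(1/(α!β!))
(∂^{α+β}E_k/∂e′^α∂λ′^β)(e′, λ′, Ω, A^{(k)}, φ)|_{e′=λ′=0}`: r15's `B3Sect1Counterterms.pert15` of the generating
function `(e′, λ′) ↦ E_k(e′, λ′, Ω, A^{(k)}, φ)` = `auxE`. [cite: Balaban1983Higgs3, (1.5) p.412] -/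
noncomputable def interaction15 (nbar : ℕ) (Ak : VecField P 0) (φ : ScalarField P k N) : ℝ :=
  B3Sect1Counterterms.pert15 (fun e' lam' => D.auxE e' lam' Ak φ) nbar

/-- (1.5) = r12's perturbative sum (I.3.36)/(I.3.62) `B1Sect3Statements.pertSum362` of `E_k` at `e = λ = 1` minus
the constant term `E_k(0, 0, Ω, A^{(k)}, φ)` (`B3Sect1Counterterms.pert15_eq_pertSum362_sub`). [cite: Balaban1983Higgs3, (1.5) p.412] -/
theorem interaction15_eq (nbar : ℕ) (Ak : VecField P 0) (φ : ScalarField P k N) :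
    D.interaction15 nbar Ak φ
      = B1Sect3Statements.pertSum362 (fun e' lam' => D.auxE e' lam' Ak φ) 1 1 nbar - D.auxE 0 0 Ak φ :=
  B3Sect1Counterterms.pert15_eq_pertSum362_sub _ nbar

/-- With `n̄ = 0` the interaction (1.5) is the empty sum. [cite: Balaban1983Higgs3, (1.5) p.412] -/
theorem interaction15_zero (Ak : VecField P 0) (φ : ScalarField P k N) : D.interaction15 0 Ak φ = 0 :=
  B3Sect1Counterterms.pert15_zero _

end Data14

/-! ## 4. Knitting (1.4) to (1.29)/(1.30): the counterterms of the data assembled from their printed pieces (v1.1) -/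

section Knitting

/-- The PIECES of the counterterms of (1.4) as printed in (1.29)/(1.30) p. 419 [PDF 9]: *"δm²(e′, g_k, λ′, Ω₁, x)(L^kε)²
= δm²_fin(e′, λ′, x)(L^kε)² + δm²_{K,k}(e′, λ′, x)(L^kε)² + δm²_k(e′e(L^kε)g_k, λ′λ(L^kε), Ω₁, x), (1.29)
E₁(e′, g_k, λ′, Ω₁) = E_fin(e′, λ′) + E_{K,k}(e′, λ′) + E_k(e′e(L^kε)g_k, λ′λ(L^kε), Ω₁), (1.30)"* — `dfin`, `dKk` =
δm²_fin, δm²_{K,k} ((1.27), (1.28); functions of `(e′, λ′, x)`), `dk` = δm²_k ((1.23); taking the position-dependent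
charge `x ↦ e′e(L^kε)g_k(x)`, the quartic coupling and the set `Ω₁`), `Efin`, `EKk`, `Ek` likewise, and the running
charge `eRun = e(L^kε)` (the quartic one, `λ(L^kε)`, is the field `lamRun` of `Data14`) — exactly the argument list of
r15's `B3Sect1Counterterms.dm2Total`/`E1Total`. [cite: Balaban1983Higgs3, (1.29)–(1.30) p.419] -/
structure Pieces129 (P : Params) where
  eRun : ℝ
  dfin : ℝ → ℝ → Site P 0 → ℝ
  dKk : ℝ → ℝ → Site P 0 → ℝ
  dk : (Site P 0 → ℝ) → ℝ → Finset (Site P 0) → Site P 0 → ℝ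
  Efin : ℝ → ℝ → ℝ
  EKk : ℝ → ℝ → ℝ
  Ek : (Site P 0 → ℝ) → ℝ → Finset (Site P 0) → ℝ

namespace Data14

variable {k : ℕ} (D : Data14 P N k) (pc : Pieces129 P)

/-- The mass counterterm `δm²(e′, g_k, λ′, Ω₁, x)` of (1.4) OBTAINED FROM (1.29): r15's `dm2Total` (which is the
product `δm²·(L^kε)²`) divided by `(L^kε)² = ell²`. [cite: Balaban1983Higgs3, (1.29) p.419] -/
noncomputable def dm2OfPieces (e' lam' : ℝ) (x : Site P 0) : ℝ :=
  B3Sect1Counterterms.dm2Total D.ell pc.eRun D.lamRun pc.dfin pc.dKk pc.dk D.g D.Ω₁ e' lam' x / D.ell ^ 2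

/-- The vacuum-energy counterterm `E₁(e′, g_k, λ′, Ω₁)` of (1.4) OBTAINED FROM (1.30): r15's `E1Total` of the pieces.
[cite: Balaban1983Higgs3, (1.30) p.419] -/
def E1OfPieces (e' lam' : ℝ) : ℝ :=
  B3Sect1Counterterms.E1Total pc.eRun D.lamRun pc.Efin pc.EKk pc.Ek D.g D.Ω₁ e' lam'

/-- **The data of (1.4) with the counterterms (1.29)/(1.30)**: the same data `D` (coupling, masses, regions, cut-off
`g_k`, scale `L^kε`, running quartic coupling) whose SUPPLIED counterterm fields `dm2`, `E1` are replaced by the ones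
assembled from the printed pieces `pc` — so that `(D.withTotals pc).auxE` is (1.4) literally composed with
(1.29)/(1.30). [cite: Balaban1983Higgs3, (1.29)–(1.30) p.419] -/
noncomputable def withTotals : Data14 P N k :=
  { D with dm2 := D.dm2OfPieces pc, E1 := D.E1OfPieces pc }

/-- The knitted data has the counterterm `dm2OfPieces`. [cite: Balaban1983Higgs3, (1.29) p.419] -/
theorem withTotals_dm2 : (D.withTotals pc).dm2 = D.dm2OfPieces pc := rfl

/-- The knitted data has the counterterm `E1OfPieces`. [cite: Balaban1983Higgs3, (1.30) p.419] -/
theorem withTotals_E1 : (D.withTotals pc).E1 = D.E1OfPieces pc := rfl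

/-- All other fields are those of `D` (coupling). [cite: Balaban1983Higgs3, (1.4) p.412] -/
theorem withTotals_C : (D.withTotals pc).C = D.C := rfl

/-- All other fields are those of `D` (vector mass). [cite: Balaban1983Higgs3, (1.4) p.412] -/
theorem withTotals_msq : (D.withTotals pc).msq = D.msq := rfl

/-- All other fields are those of `D` (precision `a`). [cite: Balaban1983Higgs3, (1.4) p.412] -/
theorem withTotals_a : (D.withTotals pc).a = D.a := rfl

/-- All other fields are those of `D` (block region `Ω^{(k)}`). [cite: Balaban1983Higgs3, (1.4) p.412] -/
theorem withTotals_Ωk : (D.withTotals pc).Ωk = D.Ωk := rfl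

/-- All other fields are those of `D` (region `Ω₁`). [cite: Balaban1983Higgs3, (1.4) p.412] -/
theorem withTotals_Ω₁ : (D.withTotals pc).Ω₁ = D.Ω₁ := rfl

/-- All other fields are those of `D` (cut-off `g_k`). [cite: Balaban1983Higgs3, (1.4) p.412] -/
theorem withTotals_g : (D.withTotals pc).g = D.g := rfl

/-- All other fields are those of `D` (scalar mass `m²`). [cite: Balaban1983Higgs3, (1.4) p.412] -/
theorem withTotals_m2 : (D.withTotals pc).m2 = D.m2 := rfl

/-- All other fields are those of `D` (scale `L^kε`). [cite: Balaban1983Higgs3, (1.4) p.412] -/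
theorem withTotals_ell : (D.withTotals pc).ell = D.ell := rfl

/-- All other fields are those of `D` (running quartic coupling). [cite: Balaban1983Higgs3, (1.4) p.412] -/
theorem withTotals_lamRun : (D.withTotals pc).lamRun = D.lamRun := rfl

/-- The region `Ω` is unchanged. [cite: Balaban1983Higgs3, (1.4) p.412] -/
theorem withTotals_Ω : (D.withTotals pc).Ω = D.Ω := rfl

/-- The operator `−Δ^η_{e′g_kA′+A^{(k)},Ω} + m²(L^kε)²` is unchanged. [cite: Balaban1983Higgs3, (1.4) p.412] -/
theorem withTotals_scalarOp (Ak : VecField P 0) (e' : ℝ) (A' : (j : Fin k) → VecField P j) :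
    (D.withTotals pc).scalarOp Ak e' A' = D.scalarOp Ak e' A' := rfl

/-- The transformation `T^η_{a_k,L^k,e′g_kA′+A^{(k)}}[Ω, ·]` is unchanged. [cite: Balaban1983Higgs3, (1.4) p.412] -/
theorem withTotals_rt14 (Ak : VecField P 0) (e' : ℝ) (A' : (j : Fin k) → VecField P j) (F : ScalarField P 0 N → ℝ)
    (φ : ScalarField P k N) : (D.withTotals pc).rt14 Ak e' A' F φ = D.rt14 Ak e' A' F φ := rfl

/-- **(1.29) verbatim for the knitted data** (`L^kε ≠ 0`): `δm²(e′,g_k,λ′,Ω₁,x)(L^kε)² = δm²_fin(e′,λ′,x)(L^kε)² +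
δm²_{K,k}(e′,λ′,x)(L^kε)² + δm²_k(e′e(L^kε)g_k, λ′λ(L^kε), Ω₁, x)`. [cite: Balaban1983Higgs3, (1.29) p.419] -/
theorem withTotals_eq129 (hℓ : D.ell ≠ 0) (e' lam' : ℝ) (x : Site P 0) :
    (D.withTotals pc).dm2 e' lam' x * D.ell ^ 2
      = pc.dfin e' lam' x * D.ell ^ 2 + pc.dKk e' lam' x * D.ell ^ 2
        + pc.dk (fun y => e' * pc.eRun * D.g y) (lam' * D.lamRun) D.Ω₁ x := by
  rw [withTotals_dm2, dm2OfPieces, div_mul_cancel₀ _ (pow_ne_zero 2 hℓ)]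
  rfl

/-- The same, in terms of r15's assembled total: `δm²·(L^kε)² = dm2Total`. [cite: Balaban1983Higgs3, (1.29) p.419] -/
theorem withTotals_dm2_mul_sq (hℓ : D.ell ≠ 0) (e' lam' : ℝ) (x : Site P 0) :
    (D.withTotals pc).dm2 e' lam' x * D.ell ^ 2
      = B3Sect1Counterterms.dm2Total D.ell pc.eRun D.lamRun pc.dfin pc.dKk pc.dk D.g D.Ω₁ e' lam' x := by
  rw [withTotals_dm2, dm2OfPieces, div_mul_cancel₀ _ (pow_ne_zero 2 hℓ)]

/-- **(1.30) verbatim for the knitted data**: `E₁(e′,g_k,λ′,Ω₁) = E_fin(e′,λ′) + E_{K,k}(e′,λ′) +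
E_k(e′e(L^kε)g_k, λ′λ(L^kε), Ω₁)`. [cite: Balaban1983Higgs3, (1.30) p.419] -/
theorem withTotals_eq130 (e' lam' : ℝ) :
    (D.withTotals pc).E1 e' lam'
      = pc.Efin e' lam' + pc.EKk e' lam' + pc.Ek (fun y => e' * pc.eRun * D.g y) (lam' * D.lamRun) D.Ω₁ := rfl

/-- **(1.4) composed with (1.29)/(1.30)** — the density of (1.4) for the knitted data, with the assembled counterterms in
place of the supplied ones (`L^kε ≠ 0`): `exp(−½⟨φ′,(−Δ^η_{e′g_kA′+A^{(k)},Ω} + m²(L^kε)²)φ′⟩ − λ′λ(L^kε)Σ_{x∈Ω₁}η^d|φ′(x)|⁴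
− ½Σ_{x∈Ω₁}η^d[δm²(e′,g_k,λ′,Ω₁,x)(L^kε)²]|φ′(x)|² − E₁(e′,g_k,λ′,Ω₁))` with `[…] = dm2Total`, `E₁ = E1Total`.
[cite: Balaban1983Higgs3, (1.4) p.412] -/
theorem withTotals_density14 (hℓ : D.ell ≠ 0) (Ak : VecField P 0) (e' lam' : ℝ) (A' : (j : Fin k) → VecField P j)
    (φ' : ScalarField P 0 N) :
    (D.withTotals pc).density14 Ak e' lam' A' φ'
      = Real.exp
        (-(1 / 2 : ℝ) * siteInner φ' (D.scalarOp Ak e' A' φ')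
          - lam' * D.lamRun * ∑ x ∈ D.Ω₁, P.mesh 0 ^ P.d * ‖φ' x‖ ^ 4
          - (1 / 2 : ℝ) * ∑ x ∈ D.Ω₁, P.mesh 0 ^ P.d
              * B3Sect1Counterterms.dm2Total D.ell pc.eRun D.lamRun pc.dfin pc.dKk pc.dk D.g D.Ω₁ e' lam' x
              * ‖φ' x‖ ^ 2
          - B3Sect1Counterterms.E1Total pc.eRun D.lamRun pc.Efin pc.EKk pc.Ek D.g D.Ω₁ e' lam') := by
  rw [density14_eq, withTotals_scalarOp, withTotals_lamRun, withTotals_Ω₁, withTotals_ell, withTotals_E1]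
  congr 1
  congr 2
  congr 1
  refine Finset.sum_congr rfl fun x _ => ?_
  rw [mul_assoc (P.mesh 0 ^ P.d), withTotals_dm2_mul_sq D pc hℓ]

/-- **(1.4) for the knitted data**: `E_k(e′,λ′,Ω,A^{(k)},φ) = −log ∫ Π_j dμ_{C^{(j),L^jη}}(A′_j) T^η[Ω, density](φ)`
with the SAME Gaussian measures and transformation as for `D` and the knitted density. [cite: Balaban1983Higgs3, (1.4) p.412] -/
theorem withTotals_auxE (e' lam' : ℝ) (Ak : VecField P 0) (φ : ScalarField P k N) :
    (D.withTotals pc).auxE e' lam' Ak φ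
      = -Real.log (∫ A', D.rt14 Ak e' A' ((D.withTotals pc).density14 Ak e' lam' A') φ
          ∂(fluctFamily P D.msq D.a k)) := rfl

/-- At `e′ = λ′ = 0` (the point at which (1.5) differentiates) the knitted mass counterterm is
`(δm²_fin(0,0,x)(L^kε)² + δm²_{K,k}(0,0,x)(L^kε)² + δm²_k(0, 0, Ω₁, x))/(L^kε)²` (`B3Sect1Counterterms.dm2Total_zero`).
[cite: Balaban1983Higgs3, (1.29) p.419] -/
theorem withTotals_dm2_zero (x : Site P 0) :
    (D.withTotals pc).dm2 0 0 x
      = (pc.dfin 0 0 x * D.ell ^ 2 + pc.dKk 0 0 x * D.ell ^ 2 + pc.dk (fun _ => 0) 0 D.Ω₁ x) / D.ell ^ 2 := by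
  rw [withTotals_dm2, dm2OfPieces, B3Sect1Counterterms.dm2Total_zero]

/-- Where the cut-off equals `1` identically (the case `Ω₁ = T`, `g_k = 1` of paper I (3.35)) the scale-`k` piece is
taken at the constant charge `e′e(L^kε)` (`B3Sect1Counterterms.dm2Total_of_g_eq_one`). [cite: Balaban1983Higgs3, (1.29) p.419] -/
theorem withTotals_dm2_of_g_eq_one (hg : ∀ y, D.g y = 1) (e' lam' : ℝ) (x : Site P 0) :
    (D.withTotals pc).dm2 e' lam' x
      = (pc.dfin e' lam' x * D.ell ^ 2 + pc.dKk e' lam' x * D.ell ^ 2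
          + pc.dk (fun _ => e' * pc.eRun) (lam' * D.lamRun) D.Ω₁ x) / D.ell ^ 2 := by
  rw [withTotals_dm2, dm2OfPieces, B3Sect1Counterterms.dm2Total_of_g_eq_one _ _ _ _ _ _ _ hg]

/-- The interaction (1.5) of the knitted data is r15's `pert15` of the knitted `E_k`. [cite: Balaban1983Higgs3, (1.5) p.412] -/
theorem withTotals_interaction15 (nbar : ℕ) (Ak : VecField P 0) (φ : ScalarField P k N) :
    (D.withTotals pc).interaction15 nbar Ak φ
      = B3Sect1Counterterms.pert15 (fun e' lam' => (D.withTotals pc).auxE e' lam' Ak φ) nbar := rfl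

end Data14

end Knitting

end Literature.MathematicalPhysics.QuantumFieldTheory.Balaban1983to89.B3Eq14AuxFunction
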